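import Summits.ResolutionOfSingularities.ResolutionOfSingularities.Theorems.PAlterationPicoverLocalBlowups
import Summits.ResolutionOfSingularities.ResolutionOfSingularities.Theorems.SectionAscentAffineToGlobalLocalModel
import Summits.ResolutionOfSingularities.ResolutionOfSingularities.Theorems.SectionAscentAffineToGlobalIdealExtension
import Summits.ResolutionOfSingularities.ResolutionOfSingularities.Theorems.WildQuotientsWildQuotientResolutionStubStableAffineCoverBlowup
import Literature.AlgebraicGeometry.Resolution.BlowupsExistence
import Literature.AlgebraicGeometry.Resolution.BlowupsProperProofs
import Literature.AlgebraicGeometry.Resolution.Blowups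
import Literature.AlgebraicGeometry.Resolution.BlowupsFlatBaseChange
import Literature.AlgebraicGeometry.Resolution.BlowupsIntegral
import Literature.AlgebraicGeometry.Resolution.AffineBlowupUniversal
import Literature.AlgebraicGeometry.Resolution.AffineBlowupCartier
import Literature.AlgebraicGeometry.Resolution.AffineDomainDimension
import Literature.AlgebraicGeometry.Resolution.RegularLocusOpen
import Literature.AlgebraicGeometry.Resolution.Temkin2008Localization
import Literature.AlgebraicGeometry.Limits.IdealSheafExtension
import HarnessLib

/-!
# Crux `AffineToGlobal` (stmt-ResolutionOfSingularities-15961), line `birth`: the true sub-case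
# "singular locus inside one affine open ⇒ one-shot ideal sheaf"

Route `ResolutionOfSingularities/SectionAscent`, crux `AffineToGlobal`
(`Summit.ResolutionOfSingularities.ResolutionOfSingularities.Theses.SectionAscent.AffineToGlobal`:
affine `Sing`-exact one-shot resolutions in characteristic `p`, all dimensions and all fields ⇒
`ResolutionInChar p`). Support file (`--supports stmt-ResolutionOfSingularities-15961`).

**Statement (`exists_oneShotSheaf_of_compl_regularLocus_subset`).** Assume the crux's
hypothesis `∀ d, OneShot p d` (written out). Let `Z` be an integral scheme of finite type over a
field `K` of characteristic `p` and `Ω ⊆ Z` an affine open containing every non-regular point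
of `Z`. Then `Z` carries an ideal sheaf `J ≠ 0` whose co-support is exactly the set of
non-regular points and all of whose blow-ups are regular schemes — i.e. `Z` itself has a
`Sing`-exact one-shot. This is the TRUE SUB-CASE of the open stub `stub_affineToModification`
isolated by the crux's disprover (`Cruxes/AffineToGlobal/Disproof.lean`, "TRUE SUB-CASE") and by
the previous lead (`Cruxes/AffineToGlobal/StubAffineToModificationAnalysis.md`, (a)); it is the
base case of every Noetherian-induction attack on the crux.

**Proof.** `Γ(Z, Ω)` is an integral `K`-algebra of finite type, of some finite Krull dimension
`n` (`exists_ringKrullDim_eq_and_trdeg_eq`), so the hypothesis at `d = n + 1` hands an ideal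
`I ⊆ Γ(Z, Ω)` with `Bl_I(Spec Γ(Z, Ω))` regular and `V(I) = Sing` exactly. Push the ideal sheaf
`Ĩ` forward along the open immersion `φ : Spec Γ(Z, Ω) → Z` (Mathlib's `IdealSheafData.map`, the
largest extension): `J := φ_* Ĩ ∩ 𝒪_Z` restricts to `Ĩ` on the chart
(`Limits.comap_map_of_isOpenImmersion`) and its co-support is the closure of `φ(V(I))`
(`support_map`), which is `Sing Z` because `Sing Z ⊆ Ω` is closed (finite type over a field,
`isClosed_compl_regularLocus_of_locallyOfFiniteType`) and local rings along `φ` are local rings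
of `Z`. A blow-up `ρ : Z' → Z` along `J` is, over the chart, the blow-up of `Spec Γ(Z, Ω)` along
`Ĩ` (flat base change, `IsBlowup.pullback_snd_of_flat`, uniqueness `IsBlowup.unique` against
`affineBlowup.isBlowup`), hence regular there; off `Sing Z = V(J)` it is an isomorphism onto the
regular locus (`IsBlowup.isIso_compl`).

Also the patching-ready local form `stub_finiteSingularLocus` (registered stub of the skeleton).
Sources: Temkin, Adv. Math. 219 (2008), §2.1–2.3 [Temkin2008]; Görtz–Wedhorn I, Prop. 13.91. -/

noncomputable section

set_option linter.dupNamespace false -- mandated namespace of this single-conjunct summit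

open CategoryTheory CategoryTheory.Limits AlgebraicGeometry TopologicalSpace
open Literature.AlgebraicGeometry.Resolution

namespace Summit.ResolutionOfSingularities.ResolutionOfSingularities.Theorems.AffineToGlobal.AffineSingularLocus

/-- The co-support of the ideal sheaf `Ĩ` of an ideal `I ⊆ A` on `Spec A` (the centre of the
affine blowing up `Bl_I(Spec A)`) is `V(I)`. (Same computation as
`Theorems.PicoverLocalModel…mem_support_ofIdealTop_iff`.) [folklore] -/
theorem mem_support_idealSheaf_iff {A : Type} [CommRing A] (I : Ideal A) (y : Spec (.of A)) :
    y ∈ (affineBlowup.idealSheaf I).support ↔ I ≤ y.asIdeal := by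
  rw [← SetLike.mem_coe, affineBlowup.idealSheaf, Scheme.IdealSheafData.coe_support_ofIdealTop,
    Ideal.map, Scheme.zeroLocus_span]
  change y ∈ (Spec (.of A)).zeroLocus ((Scheme.ΓSpecIso (.of A)).inv '' (I : Set A)) ↔ _
  rw [Spec_zeroLocus_eq_zeroLocus]
  change (I : Set A) ⊆ y.asIdeal ↔ _
  exact SetLike.coe_subset_coe

/-- The local ring of `Spec A` at `y` is regular iff the localization `A_y` is: both are
localizations of `A` at the prime `y`. [folklore] -/
theorem isRegularLocalRing_stalk_Spec_iff {A : Type} [CommRing A] (y : Spec (.of A)) :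
    IsRegularLocalRing ((Spec (.of A)).presheaf.stalk y) ↔
      IsRegularLocalRing (Localization.AtPrime y.asIdeal) := by
  let St : Type := ↥((Spec (.of A)).presheaf.stalk y)
  letI : Algebra A St := (StructureSheaf.toStalk A y).hom.toAlgebra
  haveI : IsLocalization.AtPrime St y.asIdeal := StructureSheaf.IsLocalization.to_stalk A y
  let e : St ≃ₐ[A] Localization.AtPrime y.asIdeal :=
    IsLocalization.algEquiv y.asIdeal.primeCompl St (Localization.AtPrime y.asIdeal)
  change IsRegularLocalRing St ↔ _
  exact ⟨fun _ => IsRegularLocalRing.of_ringEquiv e.toRingEquiv,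
    fun _ => IsRegularLocalRing.of_ringEquiv e.toRingEquiv.symm⟩

/-- **Singular locus inside one affine open ⇒ a `Sing`-exact one-shot ideal sheaf** (the true
sub-case of `stub_affineToModification`). Assume affine `Sing`-exact one-shots in
characteristic `p` in all dimensions (the crux's hypothesis `∀ d, OneShot p d`, written out).
If `Z` is an integral scheme of finite type over a field `K` of characteristic `p` and the affine
open `Ω ⊆ Z` contains every non-regular point of `Z`, then there is an ideal sheaf `J ≠ 0` on `Z`
whose co-support is exactly the set of non-regular points and every blow-up of which is a
regular scheme. Proof in the module docstring: one-shot ideal `I` of `Γ(Z, Ω)`, `J` the largest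
extension of `Ĩ` along the chart `Spec Γ(Z, Ω) → Z`; regularity of `Bl_J Z` over the chart by
flat base change and uniqueness of blow-ups, off `Sing Z` because the blow-up is an isomorphism
there. [cite: Temkin2008, §2.1; GortzWedhorn2020, Prop. 13.91] -/
theorem exists_oneShotSheaf_of_compl_regularLocus_subset (p : ℕ)
    (h : ∀ d : ℕ, ∀ (K : Type) [Field K] [CharP K p] (A : Type) [CommRing A] [IsDomain A]
      [Algebra K A] [Algebra.FiniteType K A], ringKrullDim A < (d : WithBot ℕ∞) →
      ∃ I : Ideal A, I ≠ ⊥ ∧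
        Literature.AlgebraicGeometry.Resolution.Scheme.IsRegular
          (Literature.AlgebraicGeometry.Resolution.affineBlowup I) ∧
        ∀ 𝔭 : PrimeSpectrum A, I ≤ 𝔭.asIdeal ↔
          ¬ IsRegularLocalRing (Localization.AtPrime 𝔭.asIdeal))
    (K : Type) [Field K] [CharP K p] (Z : Scheme.{0}) [IsIntegral Z] (f : Z ⟶ Spec (.of K))
    [LocallyOfFiniteType f] [QuasiCompact f] (Ω : Z.Opens) (hΩ : IsAffineOpen Ω)
    (hSing : (Scheme.regularLocus Z)ᶜ ⊆ (Ω : Set Z)) :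
    ∃ J : Z.IdealSheafData, J ≠ ⊥ ∧
      (∀ z : Z, z ∈ J.support ↔ ¬ IsRegularLocalRing (Z.presheaf.stalk z)) ∧
      ∀ (Z' : Scheme.{0}) (ρ : Z' ⟶ Z), IsBlowup ρ J → Scheme.IsRegular Z' := by
  classical
  haveI : IsLocallyNoetherian Z := LocallyOfFiniteType.isLocallyNoetherian f
  -- the singular locus of `Z` is closed (finite type over a field)
  haveI : IsNoetherianRing (CommRingCat.of K) := inferInstanceAs (IsNoetherianRing K)
  have hqe : Scheme.IsQuasiExcellent (Spec (CommRingCat.of K)) :=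
    Scheme.isQuasiExcellent_of_locallyOfFiniteType_of_isQuasiExcellentRing Stacks07QU_holds
      (isQuasiExcellentRing_of_field K) (𝟙 _)
  have hclosed : IsClosed (Scheme.regularLocus Z)ᶜ :=
    isClosed_compl_regularLocus_of_locallyOfFiniteType f hqe
  -- `Z` is nonempty (integral), so `⊤ ≠ ⊥` among ideal sheaves
  have htopbot : ∀ J : Z.IdealSheafData, (J.support : Set Z) = (Scheme.regularLocus Z)ᶜ → J ≠ ⊥ := by
    rintro J hJ rfl
    have h1 : genericPoint Z ∈ ((⊥ : Z.IdealSheafData).support : Set Z) := by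
      rw [Scheme.IdealSheafData.support_bot]; trivial
    rw [hJ] at h1
    exact h1 (genericPoint_mem_regularLocus Z)
  -- Case 1: `Z` is regular — the unit ideal sheaf does it.
  by_cases hall : ∀ z : Z, z ∈ Scheme.regularLocus Z
  · have hsupp : ((⊤ : Z.IdealSheafData).support : Set Z) = (Scheme.regularLocus Z)ᶜ := by
      rw [Scheme.IdealSheafData.support_top]
      ext z
      simpa using hall z
    refine ⟨⊤, htopbot ⊤ hsupp, fun z => ?_, fun Z' ρ hρ => ?_⟩
    · rw [← SetLike.mem_coe, hsupp, Set.mem_compl_iff, Scheme.mem_regularLocus]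
    · haveI := hρ.isIso isEffectiveCartier_top
      exact LocalModel.isRegular_of_flat_of_isPreimmersion ρ fun z =>
        (Scheme.mem_regularLocus z).mp (hall z)
  -- Case 2: a singular point `z₀ ∈ Ω`; `Γ(Z, Ω)` is an integral `K`-algebra of finite type.
  push Not at hall
  obtain ⟨z₀, hz₀⟩ := hall
  have hz₀Ω : z₀ ∈ (Ω : Set Z) := hSing hz₀
  haveI : Nonempty Ω := ⟨⟨z₀, hz₀Ω⟩⟩
  haveI : IsDomain Γ(Z, Ω) := IsIntegral.component_integral Ω
  letI : Algebra K Γ(Z, Ω) :=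
    ((f.appLE ⊤ Ω le_top).hom.comp (Scheme.ΓSpecIso (.of K)).inv.hom).toAlgebra
  haveI : Algebra.FiniteType K Γ(Z, Ω) := by
    have hft : RingHom.FiniteType (f.appLE ⊤ Ω le_top).hom :=
      HasRingHomProperty.appLE @LocallyOfFiniteType f inferInstance ⟨⊤, isAffineOpen_top _⟩
        ⟨Ω, hΩ⟩ le_top
    exact hft.comp (RingHom.FiniteType.of_surjective _
      (Scheme.ΓSpecIso (.of K)).commRingCatIsoToRingEquiv.symm.surjective)
  obtain ⟨n, hn, -⟩ := exists_ringKrullDim_eq_and_trdeg_eq K Γ(Z, Ω)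
  obtain ⟨I, -, hIreg, hIsing⟩ := h (n + 1) K Γ(Z, Ω) (by
    rw [hn]
    exact_mod_cast Nat.lt_succ_self n)
  -- the chart `φ : Spec Γ(Z, Ω) → Z` and the extended ideal sheaf `J`
  let φ : Spec Γ(Z, Ω) ⟶ Z := hΩ.fromSpec
  let 𝓘 : (Spec Γ(Z, Ω)).IdealSheafData := affineBlowup.idealSheaf I
  let J : Z.IdealSheafData := 𝓘.map φ
  have hJφ : J.comap φ = 𝓘 := Literature.AlgebraicGeometry.Limits.comap_map_of_isOpenImmersion φ 𝓘
  -- points of the centre of `Bl_I` are exactly the points of `Spec Γ(Z, Ω)` singular in `Z`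
  have hsupp𝓘 : ∀ y : Spec Γ(Z, Ω), y ∈ 𝓘.support ↔ φ y ∉ Scheme.regularLocus Z := by
    intro y
    rw [mem_support_idealSheaf_iff, hIsing, ← isRegularLocalRing_stalk_Spec_iff,
      ← Scheme.mem_regularLocus, mem_regularLocus_iff_of_flat_of_isPreimmersion φ y]
  -- hence `Supp(𝒪/J) = Sing Z`
  have hsuppJ : (J.support : Set Z) = (Scheme.regularLocus Z)ᶜ := by
    have h1 : (J.support : Set Z) = closure (φ '' (𝓘.support : Set (Spec Γ(Z, Ω)))) := by
      change ((𝓘.map φ).support : Set Z) = _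
      rw [Scheme.IdealSheafData.support_map]
      rfl
    rw [h1]
    apply le_antisymm
    · refine hclosed.closure_subset_iff.mpr ?_
      rintro _ ⟨y, hy, rfl⟩
      exact (hsupp𝓘 y).mp hy
    · intro z hz
      apply subset_closure
      have hzΩ : z ∈ Set.range φ := by
        change z ∈ Set.range hΩ.fromSpec
        rw [hΩ.range_fromSpec]
        exact hSing hz
      obtain ⟨y, rfl⟩ := hzΩ
      exact ⟨y, (hsupp𝓘 y).mpr hz, rfl⟩
  refine ⟨J, htopbot J hsuppJ, fun z => ?_, fun Z' ρ hρ z' => ?_⟩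
  · rw [← SetLike.mem_coe, hsuppJ, Set.mem_compl_iff, Scheme.mem_regularLocus]
  · -- regularity of a blow-up `ρ : Z' → Z` along `J` at `z'`
    by_cases hz' : ρ z' ∈ (Ω : Set Z)
    · -- over the chart: `Z' ×_Z Spec Γ(Z, Ω) ≅ Bl_I(Spec Γ(Z, Ω))` is regular
      have hb : IsBlowup (pullback.snd ρ φ) 𝓘 := hJφ ▸ hρ.pullback_snd_of_flat φ
      obtain ⟨e, -, -⟩ := hb.unique (affineBlowup.isBlowup I)
      have hPreg : Scheme.IsRegular (pullback ρ φ) :=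
        LocalModel.isRegular_of_flat_of_isPreimmersion e.hom hIreg
      have hrange : z' ∈ Set.range (pullback.fst ρ φ) := by
        rw [Scheme.Pullback.range_fst]
        change ρ z' ∈ Set.range hΩ.fromSpec
        rwa [hΩ.range_fromSpec]
      obtain ⟨t, rfl⟩ := hrange
      exact (Scheme.mem_regularLocus _).mp <|
        (mem_regularLocus_iff_of_flat_of_isPreimmersion (pullback.fst ρ φ) t).mp <|
          (Scheme.mem_regularLocus t).mpr (hPreg t)
    · -- off `Ω ⊇ Sing Z = V(J)`: `ρ` is an isomorphism over `Z ∖ V(J)` and `ρ z'` is regular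
      have hreg : ρ z' ∈ Scheme.regularLocus Z := by
        by_contra hc
        exact hz' (hSing hc)
      have hU : ρ z' ∈ (⟨(J.support : Set Z)ᶜ, J.support.isClosed.isOpen_compl⟩ : Z.Opens) := by
        change ρ z' ∈ (J.support : Set Z)ᶜ
        rw [hsuppJ, compl_compl]
        exact hreg
      haveI := hρ.isIso_compl
      exact (Scheme.mem_regularLocus z').mp <|
        (mem_regularLocus_iff_of_isIso_morphismRestrict ρ
          ⟨(J.support : Set Z)ᶜ, J.support.isClosed.isOpen_compl⟩ z' hU).mpr hreg

/-- **STUB `stub_finiteSingularLocus` of crux `AffineToGlobal` (stmt-ResolutionOfSingularities-15961),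
line `birth` (reshape 2), registered signature: finitely many singular points on a blow-up of a
local scheme of a variety ⇒ a desingularization** (the patching-ready local form). Assume affine
`Sing`-exact one-shots in characteristic `p` in all dimensions. Let `X` be integral of finite
type over a field `K` of characteristic `p`, `x ∈ X`, and `g : S' → Spec 𝒪_{X,x}` a blow-up whose
non-regular points are FINITE in number. Then `S'` admits a desingularization (Temkin's sense: a
`Sing`-supported blow-up with regular source). Proof: `S' ≅ W ×_{Spec A} Spec 𝒪_{X,x}` for an
affine chart `Spec A ∋ x` and the blow-up `W → Spec A` along the contracted centre
(`IdealExtension.stub_idealExtension`, flat base change, uniqueness); the finitely many singular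
points, seen in `W`, lie in one affine open `Ω ⊆ W` (`exists_isAffineOpen_forall_mem_of_isBlowup`:
graded prime avoidance on `Proj` of the Rees algebra); the closed set `π(Sing W ∖ Ω)` (blow-ups
are proper) misses the image of the closed point, hence a basic open `D(r)` around it, so over
`D(r)` every singular point of `W` lies in `Ω`; `exists_oneShotSheaf_of_compl_regularLocus_subset`
gives a one-shot ideal sheaf on `W' = π⁻¹D(r)` with its affine open `Ω ∩ W'`, and
`LocalModel.admitsDesingularization_pullback` along the flat preimmersion
`W ×_{Spec A} Spec 𝒪_{X,x} → W` (whose image lies in `W'`) desingularizes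
`W' ×_W (W ×_{Spec A} Spec 𝒪_{X,x}) ≅ S'`. [cite: Temkin2008, §2.1 and Prop. 2.3.4 (proof)] -/
theorem stub_finiteSingularLocus (p : ℕ) (hp : p.Prime)
    (h : ∀ d : ℕ, ∀ (K : Type) [Field K] [CharP K p] (A : Type) [CommRing A] [IsDomain A]
      [Algebra K A] [Algebra.FiniteType K A], ringKrullDim A < (d : WithBot ℕ∞) →
      ∃ I : Ideal A, I ≠ ⊥ ∧
        Literature.AlgebraicGeometry.Resolution.Scheme.IsRegular
          (Literature.AlgebraicGeometry.Resolution.affineBlowup I) ∧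
        ∀ 𝔭 : PrimeSpectrum A, I ≤ 𝔭.asIdeal ↔
          ¬ IsRegularLocalRing (Localization.AtPrime 𝔭.asIdeal))
    (K : Type) [Field K] [CharP K p] (X : Scheme.{0}) [IsIntegral X] (f : X ⟶ Spec (.of K))
    [LocallyOfFiniteType f] [QuasiCompact f] (x : X) (S' : Scheme.{0})
    (g : S' ⟶ Spec (X.presheaf.stalk x)) (I : (Spec (X.presheaf.stalk x)).IdealSheafData)
    (hg : IsBlowup g I) (hfin : (Scheme.regularLocus S')ᶜ.Finite) :
    Scheme.AdmitsDesingularization S' := by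
  classical
  have _ := hp
  -- trivial cases: the empty blow-up along `0`, and `S'` already regular
  by_cases hI : I = ⊥
  · subst hI
    haveI := hg.isEmpty_of_bot
    exact Scheme.admitsDesingularization_of_isEmpty S'
  by_cases hS'reg : ∀ s : S', s ∈ Scheme.regularLocus S'
  · exact Scheme.IsRegular.admitsDesingularization fun s =>
      (Scheme.mem_regularLocus s).mp (hS'reg s)
  push Not at hS'reg
  obtain ⟨s₀, hs₀⟩ := hS'reg
  -- an affine chart `U ∋ x`; `A = Γ(X, U)` is an integral `K`-algebra of finite type
  obtain ⟨U, hU, hxU, -⟩ :=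
    exists_isAffineOpen_mem_and_subset (X := X) (x := x) (U := ⊤) trivial
  obtain ⟨J₀, hJ₀, hJ₀I⟩ := IdealExtension.stub_idealExtension X U hU x hxU I hI
  haveI : Nonempty U := ⟨⟨x, hxU⟩⟩
  haveI : IsDomain Γ(X, U) := IsIntegral.component_integral U
  letI : Algebra K Γ(X, U) :=
    ((f.appLE ⊤ U le_top).hom.comp (Scheme.ΓSpecIso (.of K)).inv.hom).toAlgebra
  haveI hKA : Algebra.FiniteType K Γ(X, U) := by
    have hft : RingHom.FiniteType (f.appLE ⊤ U le_top).hom :=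
      HasRingHomProperty.appLE @LocallyOfFiniteType f inferInstance ⟨⊤, isAffineOpen_top _⟩
        ⟨U, hU⟩ le_top
    exact hft.comp (RingHom.FiniteType.of_surjective _
      (Scheme.ΓSpecIso (.of K)).commRingCatIsoToRingEquiv.symm.surjective)
  haveI : IsNoetherianRing Γ(X, U) := Algebra.FiniteType.isNoetherianRing K Γ(X, U)
  -- `ℓ : Spec 𝒪_{X,x} → Spec A` is a flat preimmersion (a localization)
  set ℓ : Spec (X.presheaf.stalk x) ⟶ Spec Γ(X, U) := Spec.map (X.presheaf.germ U x hxU) with hℓ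
  letI algA : Algebra Γ(X, U) (X.presheaf.stalk x) := (X.presheaf.germ U x hxU).hom.toAlgebra
  have hloc : IsLocalization.AtPrime (X.presheaf.stalk x) (hU.primeIdealOf ⟨x, hxU⟩).asIdeal :=
    hU.isLocalization_stalk ⟨x, hxU⟩
  haveI : Flat ℓ := by
    rw [hℓ, Flat.SpecMap_iff]
    have : Module.Flat Γ(X, U) (X.presheaf.stalk x) :=
      IsLocalization.flat (X.presheaf.stalk x) (hU.primeIdealOf ⟨x, hxU⟩).asIdeal.primeCompl
    exact RingHom.flat_algebraMap_iff.mpr this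
  haveI : IsPreimmersion ℓ :=
    IsPreimmersion.of_isLocalization (R := Γ(X, U)) (S := X.presheaf.stalk x)
      (hU.primeIdealOf ⟨x, hxU⟩).asIdeal.primeCompl
  -- `Spec A → Spec K` is locally of finite type
  let fA : Spec Γ(X, U) ⟶ Spec (.of K) := Spec.map (CommRingCat.ofHom (algebraMap K Γ(X, U)))
  haveI : LocallyOfFiniteType fA := by
    rw [HasRingHomProperty.Spec_iff (P := @LocallyOfFiniteType)]
    exact RingHom.finiteType_algebraMap.mpr hKA
  -- the blow-up `π : W → Spec A` along `J₀`: integral, proper, of finite type over `K`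
  obtain ⟨W, π, hπ⟩ := exists_isBlowup (Spec Γ(X, U)) J₀
  haveI : IsIntegral W := hπ.isIntegral hJ₀
  haveI : IsProper π := hπ.isProper
  let fW : W ⟶ Spec (.of K) := π ≫ fA
  haveI : LocallyOfFiniteType fW := inferInstance
  haveI : QuasiCompact fW := inferInstance
  haveI : IsLocallyNoetherian W := LocallyOfFiniteType.isLocallyNoetherian fW
  haveI : IsNoetherianRing (CommRingCat.of K) := inferInstanceAs (IsNoetherianRing K)
  have hqe : Scheme.IsQuasiExcellent (Spec (CommRingCat.of K)) :=
    Scheme.isQuasiExcellent_of_locallyOfFiniteType_of_isQuasiExcellentRing Stacks07QU_holds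
      (isQuasiExcellentRing_of_field K) (𝟙 _)
  have hWclosed : IsClosed (Scheme.regularLocus W)ᶜ :=
    isClosed_compl_regularLocus_of_locallyOfFiniteType fW hqe
  -- `P = W ×_{Spec A} Spec 𝒪_{X,x} ≅ S'` over `Spec 𝒪_{X,x}`
  rw [← hJ₀I] at hg
  obtain ⟨e, -, -⟩ := (hπ.pullback_snd_of_flat ℓ).unique hg
  -- the finitely many singular points of `S'`, seen in `W`, lie in one affine open `Ω`
  let φ : S' → W := fun s => pullback.fst π ℓ (e.inv s)
  obtain ⟨Ω, hΩ, hΩT⟩ :=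
    WildQuotientResolution.StableAffineCoverBlowup.exists_isAffineOpen_forall_mem_of_isBlowup hπ
      (hfin.image φ).toFinset
  -- every singular point of `W` lying over the image of `ℓ` is in `Ω`
  have hkey : ∀ w : W, w ∉ Scheme.regularLocus W → π w ∈ Set.range ℓ → w ∈ (Ω : Set W) := by
    intro w hw hwℓ
    have hwr : w ∈ Set.range (pullback.fst π ℓ) := by
      rw [Scheme.Pullback.range_fst]
      exact hwℓ
    obtain ⟨t, rfl⟩ := hwr
    have ht : t ∉ Scheme.regularLocus (pullback π ℓ) := fun h' =>
      hw ((mem_regularLocus_iff_of_flat_of_isPreimmersion (pullback.fst π ℓ) t).mp h')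
    have hs : e.hom t ∉ Scheme.regularLocus S' := fun h' =>
      ht ((mem_regularLocus_iff_of_flat_of_isPreimmersion e.hom t).mpr h')
    apply hΩT
    rw [Set.Finite.mem_toFinset]
    refine ⟨e.hom t, hs, ?_⟩
    change pullback.fst π ℓ (e.inv (e.hom t)) = pullback.fst π ℓ t
    rw [← Scheme.Hom.comp_apply e.hom e.inv, e.hom_inv_id]
    rfl
  -- the closed set `π(Sing W ∖ Ω)` misses the image `𝔭` of the closed point
  set C : Set W := (Scheme.regularLocus W)ᶜ ∩ (Ω : Set W)ᶜ with hCdef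
  have hC : IsClosed C := hWclosed.inter Ω.isOpen.isClosed_compl
  have hπC : IsClosed (π '' C) := π.isClosedMap _ hC
  have h𝔭 : ℓ (IsLocalRing.closedPoint (X.presheaf.stalk x)) ∈
      (⟨(π '' C)ᶜ, hπC.isOpen_compl⟩ : (Spec Γ(X, U)).Opens) := by
    rintro ⟨w, ⟨hw, hwΩ⟩, hw𝔭⟩
    exact hwΩ (hkey w hw ⟨_, hw𝔭.symm⟩)
  -- a basic open `D(r) ∋ 𝔭` inside its complement; it contains the whole image of `ℓ`
  obtain ⟨_, ⟨r, rfl⟩, h𝔭r, hrC⟩ :=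
    (Opens.isBasis_iff_nbhd.mp (isBasis_basicOpen (Spec Γ(X, U)))) h𝔭
  have hℓr : ∀ s : Spec (X.presheaf.stalk x), ℓ s ∈ (Spec Γ(X, U)).basicOpen r := fun s =>
    ((IsLocalRing.specializes_closedPoint s).map ℓ.continuous).mem_open
      ((Spec Γ(X, U)).basicOpen r).isOpen h𝔭r
  -- over `D(r)` every singular point of `W` lies in `Ω`
  have hkey2 : ∀ w : W, w ∉ Scheme.regularLocus W → π w ∈ (Spec Γ(X, U)).basicOpen r →
      w ∈ (Ω : Set W) := by
    intro w hw hwr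
    by_contra hwΩ
    exact hrC hwr ⟨w, ⟨hw, hwΩ⟩, rfl⟩
  -- the open piece `W₁ = π⁻¹D(r)` and its affine open `Ω ∩ W₁`
  set W₁ : W.Opens := π ⁻¹ᵁ (Spec Γ(X, U)).basicOpen r with hW₁
  have hΩ₁ : IsAffineOpen (Ω ⊓ W₁) := by
    have e₁ : Ω ⊓ W₁ = W.basicOpen (W.presheaf.map (homOfLE (le_top : Ω ≤ ⊤)).op (π.appTop r)) := by
      rw [Scheme.basicOpen_res, hW₁, Scheme.preimage_basicOpen_top]
    rw [e₁]
    exact hΩ.basicOpen _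
  have hΩ' : IsAffineOpen (W₁.ι ⁻¹ᵁ (Ω ⊓ W₁)) :=
    hΩ₁.preimage_of_isOpenImmersion W₁.ι (by
      rw [Scheme.Opens.opensRange_ι]
      exact inf_le_right)
  -- `W₁` is a nonempty (it carries the singular point `s₀`) integral scheme of finite type over `K`
  have hW₁ne : pullback.fst π ℓ (e.inv s₀) ∈ W₁ := by
    change π (pullback.fst π ℓ (e.inv s₀)) ∈ (Spec Γ(X, U)).basicOpen r
    rw [← Scheme.Hom.comp_apply, pullback.condition, Scheme.Hom.comp_apply]
    exact hℓr _
  haveI : Nonempty (W₁ : Scheme.{0}) := ⟨⟨_, hW₁ne⟩⟩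
  haveI : IsIntegral (W₁ : Scheme.{0}) := isIntegral_of_isOpenImmersion W₁.ι
  let fW₁ : (W₁ : Scheme.{0}) ⟶ Spec (.of K) := W₁.ι ≫ fW
  haveI : LocallyOfFiniteType fW₁ := inferInstance
  haveI : QuasiCompact fW₁ := inferInstance
  have hSing₁ : (Scheme.regularLocus (W₁ : Scheme.{0}))ᶜ ⊆
      ((W₁.ι ⁻¹ᵁ (Ω ⊓ W₁) : (W₁ : Scheme.{0}).Opens) : Set (W₁ : Scheme.{0})) := by
    intro w' hw'
    have h1 : W₁.ι w' ∉ Scheme.regularLocus W := fun h' =>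
      hw' ((mem_regularLocus_iff_of_flat_of_isPreimmersion W₁.ι w').mpr h')
    have h2 : W₁.ι w' ∈ W₁ := w'.2
    exact ⟨hkey2 _ h1 h2, h2⟩
  -- the one-shot ideal sheaf of `W₁`
  obtain ⟨J', -, hJ'supp, hJ'reg⟩ := exists_oneShotSheaf_of_compl_regularLocus_subset p h K
    (W₁ : Scheme.{0}) fW₁ (W₁.ι ⁻¹ᵁ (Ω ⊓ W₁)) hΩ' hSing₁
  -- desingularize `Q = W₁ ×_W (W ×_{Spec A} Spec 𝒪_{X,x})` along the flat preimmersion `fst`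
  have hQ := LocalModel.admitsDesingularization_pullback W (pullback π ℓ) (pullback.fst π ℓ)
    (W₁ : Scheme.{0}) W₁.ι J' (fun w hw => (hJ'supp w).mp hw) hJ'reg
  -- `Q → W ×_{Spec A} Spec 𝒪_{X,x}` is a surjective open immersion, hence an isomorphism
  have hsurj : (pullback.snd W₁.ι (pullback.fst π ℓ)).opensRange = ⊤ := by
    refine top_le_iff.mp fun t _ => ?_
    change t ∈ Set.range (pullback.snd W₁.ι (pullback.fst π ℓ))
    rw [Scheme.Pullback.range_snd, Set.mem_preimage, Scheme.Opens.range_ι]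
    change π (pullback.fst π ℓ t) ∈ (Spec Γ(X, U)).basicOpen r
    rw [← Scheme.Hom.comp_apply, pullback.condition, Scheme.Hom.comp_apply]
    exact hℓr _
  haveI := isIso_of_isOpenImmersion_of_opensRange_eq_top _ hsurj
  exact LocalModel.admitsDesingularization_of_iso
    (asIso (pullback.snd W₁.ι (pullback.fst π ℓ)) ≪≫ e) hQ

end Summit.ResolutionOfSingularities.ResolutionOfSingularities.Theorems.AffineToGlobal.AffineSingularLocus

end
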